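import Summits.MatrixMultiplication.MatrixMultiplication.Theorems.SaturationLadderTowerCeiling
import HarnessLib

/-!
# Route `SaturationLadder` on Strassen's spectrum, XIX: THE NUMBERS OF THE SCHÖNHAGE SQUARING TOWERS — every symmetric tower stays below Coppersmith's `α`, the thinnest pair below `1/4`

decomp-mm lens 1 «grading / quantitative ladder», gen 50, kernel K50-W (part 3 of 3; parts 1–2 = `SaturationLadderTowerThree`,
`SaturationLadderTowerCeiling`).  Def-free, sorry-free support module beneath the deciding crux `SubexpSaturation`
(stmt-MatrixMultiplication-25909) of `route-MatrixMultiplication-SaturationLadder`; cut of record UNCHANGED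
(`closes (h₁ : SubexpSaturation) (h₂ : SubexpToPoly) (h₃ : PolyToFinite) (h₄ : TailDescentTwo) (h₅ : SquareFromTwo)`).

THE METHOD CEILING IN NUMBERS (critic ask g50 FIRST).  Part 2 proved, for every output-perfect isolated base, the
closed-form CEILING `t_j < T := t₀ + λ₀·log r₀/(r₀A₀)` of all plateau abscissae of its squaring tower, and for
Schönhage's pairs `⟨1,(e−1)(l−1),1⟩ ⊕ ⟨e,1,l⟩`: `T(e,l) = log((e−1)(l−1))/(el·log e) + λ₀·log(el+1)/((el+1)·el·log e)`,
`λ₀ = (el+1)²/((el+1)²−1)`.  Here the numbers are certified (integer-power log certificates, `norm_num`):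
* §1 certificates `3 log 5 < 7 log 2`, `19 log 2 < 12 log 3`, `5 log 3 < 8 log 2`, `6 log 17 < 25 log 2`, `11 log 11 < 60 log 2`.
* §2 THE SYMMETRIC FAMILY `e = l = n` (third side `ρ = 1`, i.e. genuine plateaux `ω_K(1,t_j,1) = 2`):
  `T(2) = 5 log 5/(96 log 2) = 0.12093…`, `T(3) = (208 log 2 + 10 log 5)/(891 log 3) = 0.16372…` (the `E₃` tower of XVI,
  whose three certified stages were `0.1402 < 0.1432 < 0.1440`), `T(4) = (576 log 3 + 17 log 17)/(9216 log 2) = 0.10659…`,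
  and `T(n) ≤ 4/25` for `n ≥ 5` (`t₀ ≤ 2/n²`, `λ₀ ≤ 2`, `log r₀ ≤ r₀`, `A₀ = n² log n ≥ 25`) — ALL below Coppersmith's
  `α = log 4/(5 log 5) = 0.17227…` (`squareCeiling_lt_coppersmith`).  Hence (`schoenhageSquareTower`): for every `n ≥ 2`
  and every field, EVERY stage of the Schönhage-square squaring tower is a plateau `ω_K(1, t_j, 1) = 2` with
  `t_j < α` — the whole method family (Schönhage 1981 §5 / Pan 1984 §§16–17 squaring of `⟨1,Q,1⟩ ⊕ ⟨n,1,n⟩`) never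
  reaches the abscissa Coppersmith's 1982 construction already gives, let alone `t ↑ 1` (what `h₁` needs).
* §3 THE THINNEST PAIR `(2,5)` (`t₀ = 1/5`, the family's `sup` of `t₀`, census v37 I147; heavy third side `ρ = log₂5`):
  every stage is an exact thin point `ω_K(1, t_j, log 5/log 2) = 1 + log 5/log 2` with `1/5 ≤ t_j < 1/4`
  (`T(2,5) = 1/5 + 11 log 11/(1200 log 2) = 0.23171…`; `schoenhageTower_two_five`).
Recorded, not proved here (memo NODE g50 §2, exact rationals → reals): over ALL pairs the largest ceiling is
`T(2,4) = 0.24270 < 1/4`; asymmetric tower `(2,5)`: `t_j = 0.2, 0.2053178, 0.2053477, … ↑ 0.20534767` (`num/asym_tower.py`).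
Tags: `SubexpSaturation` (h₁) NEC-side ladder · WEAKER · ATTACKED · method ceiling (BC9-type, a theorem) · rows ILLUSTRATION.
[cite: Schonhage1981, §5] [cite: Pan1984, Props. 16.2–16.5, Thm. 17.1] [cite: Coppersmith1982, Theorem (BCS 1997 Thm. (15.51))]
[cite: CoppersmithWinograd1990, §6] [cite: Stothers2010, §1, Thm. 8] [cite: HuangPan1998, §2 eq. (2.8) (p. 262)]
-/

set_option linter.dupNamespace false

noncomputable section

open scoped BigOperators

namespace Summit.MatrixMultiplication.MatrixMultiplication.Theorems.SaturationLadderTowerSchoenhage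

open Literature.Computability.AlgebraicComplexity
open Summit.MatrixMultiplication.MatrixMultiplication.Theorems.SaturationLadderTowerCeiling

/-! ## §1 Integer-power log certificates -/

/-- `5³ = 125 < 128 = 2⁷`. -/
theorem three_log_five_lt : 3 * Real.log 5 < 7 * Real.log 2 := by
  have h := Real.log_lt_log (by norm_num : (0 : ℝ) < 5 ^ 3) (by norm_num : (5 : ℝ) ^ 3 < 2 ^ 7)
  rw [Real.log_pow, Real.log_pow] at h
  push_cast at h
  linarith

/-- `2¹⁹ = 524288 < 531441 = 3¹²`. -/
theorem nineteen_log_two_lt : 19 * Real.log 2 < 12 * Real.log 3 := by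
  have h := Real.log_lt_log (by norm_num : (0 : ℝ) < 2 ^ 19) (by norm_num : (2 : ℝ) ^ 19 < 3 ^ 12)
  rw [Real.log_pow, Real.log_pow] at h
  push_cast at h
  linarith

/-- `3⁵ = 243 < 256 = 2⁸`. -/
theorem five_log_three_lt : 5 * Real.log 3 < 8 * Real.log 2 := by
  have h := Real.log_lt_log (by norm_num : (0 : ℝ) < 3 ^ 5) (by norm_num : (3 : ℝ) ^ 5 < 2 ^ 8)
  rw [Real.log_pow, Real.log_pow] at h
  push_cast at h
  linarith

/-- `17⁶ = 24137569 < 33554432 = 2²⁵`. -/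
theorem six_log_seventeen_lt : 6 * Real.log 17 < 25 * Real.log 2 := by
  have h := Real.log_lt_log (by norm_num : (0 : ℝ) < 17 ^ 6) (by norm_num : (17 : ℝ) ^ 6 < 2 ^ 25)
  rw [Real.log_pow, Real.log_pow] at h
  push_cast at h
  linarith

/-- `11¹¹ = 285311670611 < 2⁶⁰`. -/
theorem eleven_log_eleven_lt : 11 * Real.log 11 < 60 * Real.log 2 := by
  have h := Real.log_lt_log (by norm_num : (0 : ℝ) < 11 ^ 11) (by norm_num : (11 : ℝ) ^ 11 < 2 ^ 60)
  rw [Real.log_pow, Real.log_pow] at h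
  push_cast at h
  linarith

/-! ## §2 The symmetric family: every ceiling below Coppersmith's `α` -/

/-- `n = 2`: `T(2) = 5 log 5/(96 log 2) = 0.12093… < α` (`⟨1,1,1⟩ ⊕ ⟨2,1,2⟩`, `r₀ = 5`, `t₀ = 0`). -/
theorem ceiling_sq_two {n : ℕ} (h : n = 2) :
    Real.log (((n - 1) * (n - 1) : ℕ) : ℝ) / ((n : ℝ) * n * Real.log n) +
      ((n : ℝ) * n + 1) ^ 2 / (((n : ℝ) * n + 1) ^ 2 - 1) *
        (Real.log ((n : ℝ) * n + 1) / (((n : ℝ) * n + 1) * ((n : ℝ) * n * Real.log n))) <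
    coppersmithExponent := by
  subst h
  have log_four : Real.log 4 = 2 * Real.log 2 := by
    rw [show (4 : ℝ) = 2 ^ 2 by norm_num, Real.log_pow]; push_cast; ring
  have h2 : 0 < Real.log 2 := Real.log_pos (by norm_num)
  have h5 : 0 < Real.log 5 := Real.log_pos (by norm_num)
  have key : 5 * Real.log 5 / (96 * Real.log 2) < coppersmithExponent := by
    rw [coppersmithExponent_eq, log_four, div_lt_div_iff₀ (by positivity) (by positivity)]
    nlinarith [mul_self_lt_mul_self (by positivity : (0 : ℝ) ≤ 3 * Real.log 5) three_log_five_lt]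
  convert key using 1
  norm_num
  field_simp
  ring

/-- `n = 3`: `T(3) = (208 log 2 + 10 log 5)/(891 log 3) = 0.16372… < α = 0.17227…` (the `E₃` tower; margin `0.0085`). -/
theorem ceiling_sq_three {n : ℕ} (h : n = 3) :
    Real.log (((n - 1) * (n - 1) : ℕ) : ℝ) / ((n : ℝ) * n * Real.log n) +
      ((n : ℝ) * n + 1) ^ 2 / (((n : ℝ) * n + 1) ^ 2 - 1) *
        (Real.log ((n : ℝ) * n + 1) / (((n : ℝ) * n + 1) * ((n : ℝ) * n * Real.log n))) <
    coppersmithExponent := by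
  subst h
  have log_four : Real.log 4 = 2 * Real.log 2 := by
    rw [show (4 : ℝ) = 2 ^ 2 by norm_num, Real.log_pow]; push_cast; ring
  have log_ten : Real.log 10 = Real.log 2 + Real.log 5 := by
    rw [show (10 : ℝ) = 2 * 5 by norm_num, Real.log_mul (by norm_num) (by norm_num)]
  have h2 : 0 < Real.log 2 := Real.log_pos (by norm_num)
  have h3 : 0 < Real.log 3 := Real.log_pos (by norm_num)
  have h5 : 0 < Real.log 5 := Real.log_pos (by norm_num)
  have key : (208 * Real.log 2 + 10 * Real.log 5) / (891 * Real.log 3) < coppersmithExponent := by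
    rw [coppersmithExponent_eq, log_four, div_lt_div_iff₀ (by positivity) (by positivity)]
    nlinarith [mul_lt_mul_of_pos_right three_log_five_lt h2, mul_lt_mul_of_pos_right three_log_five_lt h5,
      mul_lt_mul_of_pos_right nineteen_log_two_lt h2]
  convert key using 1
  norm_num
  rw [log_four, log_ten]
  field_simp
  ring

/-- `n = 4`: `T(4) = (576 log 3 + 17 log 17)/(9216 log 2) = 0.10659… < α` (Schönhage's `ω < 2.548` base `⟨1,9,1⟩ ⊕ ⟨4,1,4⟩`). -/
theorem ceiling_sq_four {n : ℕ} (h : n = 4) :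
    Real.log (((n - 1) * (n - 1) : ℕ) : ℝ) / ((n : ℝ) * n * Real.log n) +
      ((n : ℝ) * n + 1) ^ 2 / (((n : ℝ) * n + 1) ^ 2 - 1) *
        (Real.log ((n : ℝ) * n + 1) / (((n : ℝ) * n + 1) * ((n : ℝ) * n * Real.log n))) <
    coppersmithExponent := by
  subst h
  have log_four : Real.log 4 = 2 * Real.log 2 := by
    rw [show (4 : ℝ) = 2 ^ 2 by norm_num, Real.log_pow]; push_cast; ring
  have log_nine : Real.log 9 = 2 * Real.log 3 := by
    rw [show (9 : ℝ) = 3 ^ 2 by norm_num, Real.log_pow]; push_cast; ring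
  have h2 : 0 < Real.log 2 := Real.log_pos (by norm_num)
  have h3 : 0 < Real.log 3 := Real.log_pos (by norm_num)
  have h5 : 0 < Real.log 5 := Real.log_pos (by norm_num)
  have h17 : 0 < Real.log 17 := Real.log_pos (by norm_num)
  have key : (576 * Real.log 3 + 17 * Real.log 17) / (9216 * Real.log 2) < coppersmithExponent := by
    rw [coppersmithExponent_eq, log_four, div_lt_div_iff₀ (by positivity) (by positivity)]
    nlinarith [mul_lt_mul_of_pos_right five_log_three_lt h5, mul_lt_mul_of_pos_right six_log_seventeen_lt h5,
      mul_lt_mul_of_pos_right three_log_five_lt h2]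
  convert key using 1
  norm_num
  rw [log_four, log_nine]
  field_simp
  ring

/-- `n ≥ 5`: `T(n) ≤ 2/n² + 2/(n² log n) ≤ 4/25` (`log((n−1)²) ≤ 2 log n`, `λ₀ ≤ 2`, `log r₀ ≤ r₀`, `n² log n ≥ 25`, `log 5 > 1`). -/
theorem ceiling_sq_ge_five {n : ℕ} (hn : 5 ≤ n) :
    Real.log (((n - 1) * (n - 1) : ℕ) : ℝ) / ((n : ℝ) * n * Real.log n) +
      ((n : ℝ) * n + 1) ^ 2 / (((n : ℝ) * n + 1) ^ 2 - 1) *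
        (Real.log ((n : ℝ) * n + 1) / (((n : ℝ) * n + 1) * ((n : ℝ) * n * Real.log n))) ≤ 4 / 25 := by
  have hn5 : (5 : ℝ) ≤ n := by exact_mod_cast hn
  have hlog1 : 1 < Real.log (n : ℝ) := by
    rw [Real.lt_log_iff_exp_lt (by linarith)]
    exact Real.exp_one_lt_d9.trans_le (by linarith)
  have hlogpos : 0 < Real.log (n : ℝ) := by linarith
  have hN : (25 : ℝ) ≤ (n : ℝ) * n := by nlinarith
  have hA : (25 : ℝ) ≤ (n : ℝ) * n * Real.log n := by nlinarith
  have hApos : (0 : ℝ) < (n : ℝ) * n * Real.log n := by positivity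
  -- first term ≤ 2/25
  have h1 : Real.log (((n - 1) * (n - 1) : ℕ) : ℝ) ≤ 2 * Real.log n := by
    have hle : (((n - 1) * (n - 1) : ℕ) : ℝ) ≤ (n : ℝ) ^ 2 := by
      have : (n - 1) * (n - 1) ≤ n ^ 2 := by
        calc (n - 1) * (n - 1) ≤ n * n := Nat.mul_le_mul (Nat.sub_le n 1) (Nat.sub_le n 1)
          _ = n ^ 2 := (sq n).symm
      exact_mod_cast this
    have hpos : (0 : ℝ) < (((n - 1) * (n - 1) : ℕ) : ℝ) := by
      have : 0 < (n - 1) * (n - 1) := Nat.mul_pos (by omega) (by omega)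
      exact_mod_cast this
    calc Real.log _ ≤ Real.log ((n : ℝ) ^ 2) := Real.log_le_log hpos hle
      _ = 2 * Real.log n := by rw [Real.log_pow]; push_cast; ring
  have t1 : Real.log (((n - 1) * (n - 1) : ℕ) : ℝ) / ((n : ℝ) * n * Real.log n) ≤ 2 / 25 := by
    rw [div_le_div_iff₀ hApos (by norm_num)]
    nlinarith [mul_le_mul_of_nonneg_right hN hlogpos.le]
  -- second term ≤ 2 · (1/25)
  set R : ℝ := (n : ℝ) * n + 1 with hR
  have hR26 : (26 : ℝ) ≤ R := by rw [hR]; linarith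
  have hRpos : 0 < R := by linarith
  have hden : 0 < R ^ 2 - 1 := by nlinarith
  have hl2 : R ^ 2 / (R ^ 2 - 1) ≤ 2 := by
    rw [div_le_iff₀ hden]; nlinarith
  have hw : Real.log R / (R * ((n : ℝ) * n * Real.log n)) ≤ 1 / 25 := by
    have hlogR : Real.log R ≤ R := (Real.log_le_sub_one_of_pos hRpos).trans (by linarith)
    rw [div_le_div_iff₀ (by positivity) (by norm_num)]
    nlinarith [mul_le_mul_of_nonneg_left hA hRpos.le]
  have hw0 : 0 ≤ Real.log R / (R * ((n : ℝ) * n * Real.log n)) :=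
    div_nonneg (Real.log_nonneg (by linarith)) (by positivity)
  have t2 : R ^ 2 / (R ^ 2 - 1) * (Real.log R / (R * ((n : ℝ) * n * Real.log n))) ≤ 2 * (1 / 25) :=
    mul_le_mul hl2 hw hw0 (by norm_num)
  linarith

/-- **THE SYMMETRIC SCHÖNHAGE SQUARING TOWERS NEVER REACH COPPERSMITH'S `α`.**  For every `n ≥ 2` the closed-form ceiling
`T(n) = log((n−1)²)/(n² log n) + λ₀·log(n²+1)/((n²+1)·n²·log n)`, `λ₀ = (n²+1)²/((n²+1)²−1)`, of the squaring tower on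
`⟨1,(n−1)²,1⟩ ⊕ ⟨n,1,n⟩` satisfies `T(n) < α = log 4/(5 log 5) = 0.17227…` (max `T(3) = 0.16372…`).
[cite: Coppersmith1982, Theorem (BCS 1997 Thm. (15.51))] [cite: Schonhage1981, §5] [cite: Pan1984, Props. 16.2–16.5] -/
theorem squareCeiling_lt_coppersmith (n : ℕ) (hn : 2 ≤ n) :
    Real.log (((n - 1) * (n - 1) : ℕ) : ℝ) / ((n : ℝ) * n * Real.log n) +
      ((n : ℝ) * n + 1) ^ 2 / (((n : ℝ) * n + 1) ^ 2 - 1) *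
        (Real.log ((n : ℝ) * n + 1) / (((n : ℝ) * n + 1) * ((n : ℝ) * n * Real.log n))) <
    coppersmithExponent := by
  rcases (by omega : n = 2 ∨ n = 3 ∨ n = 4 ∨ 5 ≤ n) with h | h | h | h
  · exact ceiling_sq_two h
  · exact ceiling_sq_three h
  · exact ceiling_sq_four h
  · exact (ceiling_sq_ge_five h).trans_lt (lt_trans (by norm_num) coppersmithExponent_gt)

variable (K : Type) [Field K]

/-- **EVERY STAGE OF EVERY SYMMETRIC SCHÖNHAGE SQUARING TOWER IS A PLATEAU BELOW `α`.**  For `n ≥ 2` and every field `K`: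
the squaring tower on the isolated base `⟨1,(n−1)²,1⟩ ⊕ ⟨n,1,n⟩` (route `FarEdgeDescent` XXXV-C, `r₀ = n² + 1`) has
plateau abscissae `t₀ = log((n−1)²)/(n²·log n) < t₁ < t₂ < …`, every one a genuine plateau `ω_K(1, t_j, 1) = 2`, and
`t_j < α = 0.17227…` for ALL `j` — the method (Schönhage 1981 §5, Pan 1984 §§16–17; `n = 3`: XVI `e3_thinTower`,
`n = 4`: Schönhage's `ω < 2.548` base) cannot even reproduce Coppersmith's 1982 abscissa, let alone drive `t ↑ 1`.
[cite: Schonhage1981, §5] [cite: Pan1984, Props. 16.2–16.5, Thm. 17.1] [cite: Coppersmith1982, Theorem (BCS 1997 Thm. (15.51))]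
[cite: Stothers2010, §1, Thm. 8] -/
theorem schoenhageSquareTower (n : ℕ) (hn : 2 ≤ n) :
    ∃ t : ℕ → ℝ,
      t 0 = Real.log (((n - 1) * (n - 1) : ℕ) : ℝ) / ((n : ℝ) * n * Real.log n) ∧
      (∀ j, t j < t (j + 1)) ∧ (∀ j, omegaRect K 1 (t j) 1 = 2) ∧ ∀ j, t j < coppersmithExponent := by
  obtain ⟨t, r, A, ht0, -, -, -, -, hstep, hpt, -, hceil⟩ := schoenhagePairTower K n n hn hn
  have hlog : Real.log (n : ℝ) ≠ 0 := (Real.log_pos (by exact_mod_cast hn : (1 : ℝ) < n)).ne'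
  refine ⟨t, ht0, hstep, fun j => ?_, fun j => (hceil j).trans (squareCeiling_lt_coppersmith n hn)⟩
  have h := hpt j
  rw [div_self hlog] at h
  rw [h]
  norm_num

/-! ## §3 The thinnest pair `(2,5)`: all stages exact at `ρ = log₂ 5`, between `1/5` and `1/4` -/

/-- **THE `(2,5)` TOWER**: on the isolated base `⟨1,4,1⟩ ⊕ ⟨2,1,5⟩` (`r₀ = 11`) every squaring stage is an exact thin
point `ω_K(1, t_j, log 5/log 2) = 1 + log 5/log 2` over every field, `1/5 = t₀ < t₁ < … < 1/4`
(ceiling `T(2,5) = 1/5 + 11 log 11/(1200 log 2) = 0.23171…`, certificate `11¹¹ < 2⁶⁰`; numerically `t_j ↑ 0.2053477`).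
[cite: Schonhage1981, §5] [cite: HuangPan1998, §2 eq. (2.8) (p. 262)] [cite: Pan1984, Props. 16.2–16.5] -/
theorem schoenhageTower_two_five :
    ∃ t : ℕ → ℝ,
      t 0 = 1 / 5 ∧ (∀ j, t j < t (j + 1)) ∧
      (∀ j, omegaRect K 1 (t j) (Real.log 5 / Real.log 2) = 1 + Real.log 5 / Real.log 2) ∧
      ∀ j, t j < 1 / 4 := by
  obtain ⟨t, r, A, ht0, -, -, -, -, hstep, hpt, -, hceil⟩ :=
    schoenhagePairTower K 2 5 (by norm_num) (by norm_num)
  have log_four : Real.log 4 = 2 * Real.log 2 := by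
    rw [show (4 : ℝ) = 2 ^ 2 by norm_num, Real.log_pow]; push_cast; ring
  have h2 : 0 < Real.log 2 := Real.log_pos (by norm_num)
  have h11 : 0 < Real.log 11 := Real.log_pos (by norm_num)
  have e0 : Real.log (((2 - 1) * (5 - 1) : ℕ) : ℝ) / (((2 : ℕ) : ℝ) * ((5 : ℕ) : ℝ) * Real.log ((2 : ℕ) : ℝ)) =
      1 / 5 := by
    norm_num
    rw [log_four]
    field_simp
    ring
  have e1 : Real.log (((2 - 1) * (5 - 1) : ℕ) : ℝ) / (((2 : ℕ) : ℝ) * ((5 : ℕ) : ℝ) * Real.log ((2 : ℕ) : ℝ)) +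
      (((2 : ℕ) : ℝ) * ((5 : ℕ) : ℝ) + 1) ^ 2 / ((((2 : ℕ) : ℝ) * ((5 : ℕ) : ℝ) + 1) ^ 2 - 1) *
        (Real.log (((2 : ℕ) : ℝ) * ((5 : ℕ) : ℝ) + 1) /
          ((((2 : ℕ) : ℝ) * ((5 : ℕ) : ℝ) + 1) * (((2 : ℕ) : ℝ) * ((5 : ℕ) : ℝ) * Real.log ((2 : ℕ) : ℝ)))) =
      1 / 5 + 11 * Real.log 11 / (1200 * Real.log 2) := by
    norm_num
    rw [log_four]
    field_simp
    ring
  have key : 1 / 5 + 11 * Real.log 11 / (1200 * Real.log 2) < 1 / 4 := by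
    have : 11 * Real.log 11 / (1200 * Real.log 2) < 1 / 20 := by
      rw [div_lt_div_iff₀ (by positivity) (by norm_num)]
      nlinarith [eleven_log_eleven_lt]
    linarith
  have hpt' : ∀ j, omegaRect K 1 (t j) (Real.log 5 / Real.log 2) = 1 + Real.log 5 / Real.log 2 := fun j => by
    have h := hpt j
    norm_num at h
    exact h
  refine ⟨t, by rw [ht0, e0], hstep, hpt', fun j => ?_⟩
  have h := hceil j
  rw [e1] at h
  exact h.trans key

end Summit.MatrixMultiplication.MatrixMultiplication.Theorems.SaturationLadderTowerSchoenhage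

end
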